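import Summits.CriticalPhenomena.SAWScalingLimit.Theorems.SAWDevelopingMapHexTransferPinLineReduction

/-!
# By-product of line `pin-the-shear` (crux `HexTransfer`, stmt-CriticalPhenomena-14221) for route
# SAWCompassLattice: `YBSquareSLE` is only needed MODULO AN UNIDENTIFIED LINEAR MAP

Route SAWCompassLattice closes `SAWScalingLimit` from its crux `YBSquareSLE` (stmt-CriticalPhenomena-6967:
chordal SLE(8/3) convergence of Glazman–Manolescu's critical Yang–Baxter walk on the square tiling
`Θ ≡ π/2`) and `SurfaceUniversality` (stmt-6964) — `Sketch.sawScalingLimit_of_ybSquareSLE_of_surfaceUniversality`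
(cycle 1 of this line). The pin of line `pin-the-shear` (exact quarter-turn covariance of the `δℤ²`
law, conjugate-rotation covariance, GL₂⁺-rigidity of the SLE(8/3) family from stretch rigidity,
similarity identification — all theorems of the tree now) shows that the compass route needs
`YBSquareSLE` only in the weaker form "**modulo GL₂⁺**": it suffices that for ONE linear map `Φ` of
positive determinant the `π/2` Yang–Baxter law of every Dobrushin domain `D` (every port endpoint
approximation) converges in law to `Φ ∘ Γ_D`, `Γ_D` an SLE(8/3) curve of `Φ⁻¹(D)` — the shape a
coupling / developing-map argument with an uncomputed drift would produce.

* `imageLimit_of_ybImageLimit` — port transfer + surface universality move a `Φ`-image limit of the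
  `π/2` Yang–Baxter laws to a `Φ`-image limit of the critical `δℤ²` SAW laws;
* `sawScalingLimit_of_ybSquareSLE_modulo_linear` — `(YBSquareSLE modulo GL₂⁺) → SurfaceUniversality →
  SAWScalingLimit`.
-/

noncomputable section

namespace Summit.CriticalPhenomena.SAWScalingLimit.Cruxes.HexTransfer.PinTheShear

open MeasureTheory Filter Topology Set
open scoped NNReal ENNReal
open Literature.Probability.RandomPlanarGeometry
open Literature.Probability.RandomPlanarGeometry.SAW.YangBaxter
open Literature.Probability.LatticeModels (Site HexVertex hexGraph hexCenter)
open Literature.Probability (Process.preWienerMeasure)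
open Summit.CriticalPhenomena.SAWScalingLimit.Theses
open Summit.CriticalPhenomena.SAWScalingLimit.Cruxes.HexTransfer.Sketch
open Summit.CriticalPhenomena.SAWScalingLimit.Cruxes.HexTransfer.Sketch.PortTransfer

/-- **From a `Φ`-image limit of the `π/2` Yang–Baxter laws to a `Φ`-image limit of the `δℤ²` laws**
(port transfer of line `Sketch` + surface universality, two-ε). [folklore] -/
theorem imageLimit_of_ybImageLimit (hU : SAWCompassLattice.SurfaceUniversality) {Φ : ℂ ≃ₜ ℂ}
    (hY : ∀ (D : DobrushinDomain) (a b : ℝ → MidEdge),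
      IsYBEndpointApprox (fun (_ : ℤ) => Real.pi / 2) D a b →
      ∃ Γ : (ℝ≥0 → ℝ) → CurveClass ℂ, IsSLECurve ((8 : ℝ≥0) / 3) (D.map Φ.symm) Γ ∧
        TendstoLaw
          (fun δ (γ : YangBaxterSAW (fun (_ : ℤ) => Real.pi / 2) D.carrier δ (a δ) (b δ)) =>
            γ.curve (fun (_ : ℤ) => Real.pi / 2) δ)
          (fun δ => ybLaw (fun (_ : ℤ) => Real.pi / 2) D.carrier δ 1 (a δ) (b δ))
          (fun ω => CurveClass.map (Φ : C(ℂ, ℂ)) (Γ ω)) Process.preWienerMeasure) :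
    ∀ (D : DobrushinDomain) (a b : ℝ → Site 2), SAW.IsEndpointApprox D a b →
      ∃ Γ : (ℝ≥0 → ℝ) → CurveClass ℂ, IsSLECurve ((8 : ℝ≥0) / 3) (D.map Φ.symm) Γ ∧
        TendstoLaw (fun δ (γ : SAW.DomainSAW D.carrier δ (a δ) (b δ)) => γ.curve)
          (fun δ => SAW.law D.carrier δ (a δ) (b δ))
          (fun ω => CurveClass.map (Φ : C(ℂ, ℂ)) (Γ ω)) Process.preWienerMeasure := by
  intro D a b hab
  obtain ⟨a', b', hab'⟩ := stub_compassEndpoints D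
  obtain ⟨Γ, hΓ, h1⟩ := hY D a' b' hab'
  refine ⟨Γ, hΓ, ?_⟩
  haveI := isProbabilityMeasure_preWienerMeasure'
  have hΦc : Continuous (CurveClass.map (Φ : C(ℂ, ℂ))) := CurveClass.continuous_map _
  have hZ : AEMeasurable (fun ω => CurveClass.map (Φ : C(ℂ, ℂ)) (Γ ω)) Process.preWienerMeasure :=
    hΦc.measurable.comp_aemeasurable hΓ.aemeasurable
  -- Step 2: the compass law from the same ports converges in law to `Φ ∘ Γ` (port transfer)
  obtain ⟨α, β, s, z, hsol⟩ := stub_compassRealisation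
  have hP : SAWCompassLattice.PortDictionary := stub_portDictionary
  have h2 : TendstoLaw (fun (_ : ℝ) (x : CurveClass ℂ) => x)
      (fun δ => compassLaw α β s z D.carrier δ (a' δ) (b' δ))
      (fun ω => CurveClass.map (Φ : C(ℂ, ℂ)) (Γ ω)) Process.preWienerMeasure := by
    have hT' : TendstoLaw
        (fun δ (p : CPath D.carrier δ (a' δ) (b' δ)) =>
          (toYB hP hsol p).curve (fun (_ : ℤ) => Real.pi / 2) δ)
        (fun δ => compassRho α β s z D.carrier δ (a' δ) (b' δ))
        (fun ω => CurveClass.map (Φ : C(ℂ, ℂ)) (Γ ω)) Process.preWienerMeasure := by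
      intro f
      refine (h1 f).congr fun δ => ?_
      change ∫ γ, f (γ.curve (fun (_ : ℤ) => Real.pi / 2) δ)
          ∂(ybLaw (fun (_ : ℤ) => Real.pi / 2) D.carrier δ 1 (a' δ) (b' δ)) = _
      rw [ybLaw_eq_map hP hsol, integral_map (measurable_cpath _).aemeasurable]
      exact (YBWalk.measurable_of_top _).aestronglyMeasurable
    have hε : Tendsto (fun δ : ℝ => |δ|) (𝓝[>] 0) (𝓝 0) :=
      (continuous_abs.tendsto' (0 : ℝ) 0 abs_zero).mono_left nhdsWithin_le_nhds
    have hT'' := tendstoLaw_of_dist_le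
      (Y := fun δ (p : CPath D.carrier δ (a' δ) (b' δ)) => compassCurve δ p)
      (fun δ => compassRho_zero_or_prob α β s z D.carrier δ (a' δ) (b' δ))
      (fun δ => (measurable_cpath _).aemeasurable) (fun δ => (measurable_cpath _).aemeasurable)
      hZ hε (fun δ p => dist_compassCurve_curve_le p _ (toYB_mids hP hsol p)) hT'
    intro f
    refine (hT'' f).congr fun δ => ?_
    change _ = ∫ x, f x ∂(compassLaw α β s z D.carrier δ (a' δ) (b' δ))
    rw [compassLaw_eq_map, integral_map (measurable_cpath _).aemeasurable
      f.continuous.aestronglyMeasurable]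
  -- Step 3: surface universality moves the limit to the uniform `δℤ²` law (two-ε)
  intro f
  have h3 : Tendsto (fun δ => (∫ γ, f γ.curve ∂(SAW.law D.carrier δ (a δ) (b δ))) -
      ∫ x, f x ∂(compassLaw α β s z D.carrier δ (a' δ) (b' δ))) (𝓝[>] 0) (𝓝 0) :=
    hU α β s z hsol D a b a' b' hab hab' f
  have h := h3.add (h2 f)
  rw [zero_add] at h
  exact h.congr fun δ => sub_add_cancel _ _

/-- **Route SAWCompassLattice needs `YBSquareSLE` only modulo GL₂⁺.** If for ONE linear map of
positive determinant the critical `π/2` Yang–Baxter law of every Dobrushin domain converges in law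
to the linear image of an SLE(8/3) curve of the preimage domain, and surface universality
(stmt-6964) holds, then `SAWScalingLimit`: the pin of line `pin-the-shear` identifies the linear map
as a similarity. [folklore] -/
theorem sawScalingLimit_of_ybSquareSLE_modulo_linear
    (hY : ∃ m₁₁ m₁₂ m₂₁ m₂₂ : ℝ, 0 < m₁₁ * m₂₂ - m₁₂ * m₂₁ ∧ ∀ Φ : ℂ ≃ₜ ℂ,
      (∀ z : ℂ, Φ z = ((m₁₁ * z.re + m₁₂ * z.im : ℝ) : ℂ) +
          ((m₂₁ * z.re + m₂₂ * z.im : ℝ) : ℂ) * Complex.I) →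
      ∀ (D : DobrushinDomain) (a b : ℝ → MidEdge),
        IsYBEndpointApprox (fun (_ : ℤ) => Real.pi / 2) D a b →
        ∃ Γ : (ℝ≥0 → ℝ) → CurveClass ℂ, IsSLECurve ((8 : ℝ≥0) / 3) (D.map Φ.symm) Γ ∧
          TendstoLaw
            (fun δ (γ : YangBaxterSAW (fun (_ : ℤ) => Real.pi / 2) D.carrier δ (a δ) (b δ)) =>
              γ.curve (fun (_ : ℤ) => Real.pi / 2) δ)
            (fun δ => ybLaw (fun (_ : ℤ) => Real.pi / 2) D.carrier δ 1 (a δ) (b δ))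
            (fun ω => CurveClass.map (Φ : C(ℂ, ℂ)) (Γ ω)) Process.preWienerMeasure)
    (hU : SAWCompassLattice.SurfaceUniversality) : _root_.SAWScalingLimit := by
  obtain ⟨m₁₁, m₁₂, m₂₁, m₂₂, hdet, hT⟩ := hY
  have hd0 : m₁₁ * m₂₂ - m₁₂ * m₂₁ ≠ 0 := hdet.ne'
  obtain ⟨Φ₀, hΦ₀, hΦ₀'⟩ := exists_linear_homeomorph hd0
  have hIL₀ := imageLimit_of_ybImageLimit hU (hT Φ₀ hΦ₀)
  have hcov := stub_conjugateRotationCovariance Φ₀ hIL₀ stub_quarterTurnCovariance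
  have hψdet : 0 < (-(m₁₁ * m₁₂ + m₂₁ * m₂₂) / (m₁₁ * m₂₂ - m₁₂ * m₂₁)) *
        ((m₁₁ * m₁₂ + m₂₁ * m₂₂) / (m₁₁ * m₂₂ - m₁₂ * m₂₁)) -
      (-(m₁₂ ^ 2 + m₂₂ ^ 2) / (m₁₁ * m₂₂ - m₁₂ * m₂₁)) *
        ((m₁₁ ^ 2 + m₂₁ ^ 2) / (m₁₁ * m₂₂ - m₁₂ * m₂₁)) := by
    rw [conjRot_det hd0]
    exact one_pos
  have hpin := stub_linearPinning stub_stretchRigidity _ _ _ _ hψdet _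
    (conjRot_formula_of hΦ₀ hΦ₀') hcov
  obtain ⟨h12, h22⟩ := entries_of_conj_pinned hdet hpin.1 hpin.2
  have hc : (⟨m₁₁, m₂₁⟩ : ℂ) ≠ 0 := by
    intro h
    have h1 : m₁₁ = 0 := by simpa using congrArg Complex.re h
    have h2 : m₂₁ = 0 := by simpa using congrArg Complex.im h
    rw [h1, h2] at hdet
    simp at hdet
  refine stub_similarityIdentification ⟨m₁₁, m₂₁⟩ hc
    (imageLimit_of_ybImageLimit hU (hT _ fun z => ?_))
  rw [similarity_apply, add_zero, h12, h22]
  apply Complex.ext <;> simp <;> ring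

end Summit.CriticalPhenomena.SAWScalingLimit.Cruxes.HexTransfer.PinTheShear

end
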